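import Literature.NumberTheory.LFunctions.WeilZeroSum
import Literature.NumberTheory.LFunctions.ZetaZerosReflection
import Literature.NumberTheory.LFunctions.PerronTruncated
import HarnessLib

/-!
# Route IntegerScrew — the Landau pairing of a Dirichlet polynomial over the zeros of `ζ`

Helper file for crux `IntegerScrew.ScrewPolyFloor` (stmt-RiemannHypothesis-15757), idea card
`Cruxes/ScrewPolyFloor/Ideas/abscissa-blind-head.md` and line `Lines/landau_gonek_floor.lean`: the
unconditional zero expansion of the screw form (`hasSum_screwForm`,
`Cruxes/ScrewPolyFloor/IntegerScrewFloorOfRH.lean`) is written in LANDAU CHARACTERS — for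
`P_y(s) = ∑_{m ≤ M} y_m m^s` and a zero `ρ`,

  `P_y(ρ − ½) P_y(½ − ρ) = ∑_{m,m'} y_m y_m' (m'/m)^{1/2} (m/m')^ρ`   (`pairing_eq`),

so that the truncated pairing over the zeros with `|Im ρ| ≤ T`,
`D(T) = ∑_{|Im ρ| ≤ T} m(ρ) P_y(ρ−½)P_y(½−ρ) = ∑_{m,m'} y_m y_m' (m'/m)^{1/2} L(m/m'; T)`
(`pairingSum_eq`), is a combination of Landau sums `L(x;T) = ∑_{|Im ρ| ≤ T} m(ρ) x^ρ`
(`Literature.NumberTheory.LFunctions.LandauGonek.landau_gonek_formula`). This file also records the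
reflection symmetry `L(x;T) = x·L(x⁻¹;T)` (`landauSum_reflect`, from `ρ ↦ 1 − ρ` on the zeros and
`m(1−ρ) = m(ρ)`, `riemannZetaZeroOrder_one_sub_holds`) and `L(1;T) = ∑_{|Im ρ| ≤ T} m(ρ)`
(`landauSum_one`), which reduce the pairs `m < m'` to `m > m'` and evaluate the diagonal.

No `def`s: the sums are written out (Landau sum over `(weilZeroIndex_finite T).toFinset`, Dirichlet
polynomial over `Finset.Icc 1 M`, as in `hasSum_screwForm`).
-/

noncomputable section

open Complex Finset
open scoped Real ComplexConjugate

-- the layout-mandated namespace repeats the summit name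
set_option linter.dupNamespace false

namespace Summit.RiemannHypothesis.RiemannHypothesis.Theorems.IntegerScrewLandau

open Literature.NumberTheory.LFunctions

/-! ### The Landau sum: reflection and the diagonal -/

/-- Membership in the index set of the Landau sum, unfolded. [folklore] -/
theorem mem_weilZeroIndex_toFinset {T : ℝ} {ρ : ℂ} :
    ρ ∈ (weilZeroIndex_finite T).toFinset ↔
      riemannZeta ρ = 0 ∧ 0 ≤ ρ.re ∧ ρ.re ≤ 1 ∧ ρ.im ≠ 0 ∧ |ρ.im| ≤ T := by
  rw [Set.Finite.mem_toFinset]; rfl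

/-- `ρ ↦ 1 − ρ` preserves the index set of the Landau sum (functional equation). [folklore] -/
theorem one_sub_mem_weilZeroIndex_toFinset {T : ℝ} {ρ : ℂ} (h : ρ ∈ (weilZeroIndex_finite T).toFinset) :
    1 - ρ ∈ (weilZeroIndex_finite T).toFinset := by
  rw [mem_weilZeroIndex_toFinset] at h ⊢
  obtain ⟨h0, h1, h2, h3, h4⟩ := h
  have hmem := ZetaZeros.riemannZetaNontrivialZeros.mem_of_im_ne_zero h0 h3
  refine ⟨GeneralizedRH.riemannZeta_one_sub_eq_zero h0
      (ZetaZeros.riemannZetaNontrivialZeros.re_pos hmem)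
      (ZetaZeros.riemannZetaNontrivialZeros.re_lt_one hmem), ?_, ?_, ?_, ?_⟩
  · simp; linarith
  · simp; linarith
  · simpa using h3
  · simpa [abs_neg] using h4

/-- **Reflection.** For real `x > 0`: `∑_{|Im ρ| ≤ T} m(ρ) x^ρ = x ∑_{|Im ρ| ≤ T} m(ρ) (x⁻¹)^ρ`
(reindex by `ρ ↦ 1 − ρ`, `m(1−ρ) = m(ρ)`, `x^{1−ρ} = x (x⁻¹)^ρ`). [folklore] -/
theorem landauSum_reflect {x : ℝ} (hx : 0 < x) (T : ℝ) :
    ∑ ρ ∈ (weilZeroIndex_finite T).toFinset, (riemannZetaZeroOrder ρ : ℂ) * (x : ℂ) ^ ρ =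
      (x : ℂ) * ∑ ρ ∈ (weilZeroIndex_finite T).toFinset,
        (riemannZetaZeroOrder ρ : ℂ) * ((x⁻¹ : ℝ) : ℂ) ^ ρ := by
  rw [Finset.mul_sum]
  refine Finset.sum_nbij' (fun ρ ↦ 1 - ρ) (fun ρ ↦ 1 - ρ)
    (fun ρ hρ ↦ one_sub_mem_weilZeroIndex_toFinset hρ)
    (fun ρ hρ ↦ one_sub_mem_weilZeroIndex_toFinset hρ)
    (fun ρ _ ↦ by simp) (fun ρ _ ↦ by simp) (fun ρ hρ ↦ ?_)
  rw [mem_weilZeroIndex_toFinset] at hρ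
  obtain ⟨h0, -, -, h3, -⟩ := hρ
  have hmem := ZetaZeros.riemannZetaNontrivialZeros.mem_of_im_ne_zero h0 h3
  have horder : riemannZetaZeroOrder (1 - ρ) = riemannZetaZeroOrder ρ :=
    riemannZetaZeroOrder_one_sub_holds (ZetaZeros.riemannZetaNontrivialZeros.re_pos hmem)
      (ZetaZeros.riemannZetaNontrivialZeros.re_lt_one hmem)
  have hx0 : (x : ℂ) ≠ 0 := by exact_mod_cast hx.ne'
  have harg : ((x : ℝ) : ℂ).arg ≠ π := by
    rw [Complex.arg_ofReal_of_nonneg hx.le]; exact Real.pi_pos.ne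
  rw [horder, ofReal_inv, inv_cpow _ _ harg, cpow_sub _ _ hx0, cpow_one]
  field_simp

/-- **The diagonal.** `∑_{|Im ρ| ≤ T} m(ρ) 1^ρ = ∑_{|Im ρ| ≤ T} m(ρ)`. [folklore] -/
theorem landauSum_one (T : ℝ) :
    ∑ ρ ∈ (weilZeroIndex_finite T).toFinset, (riemannZetaZeroOrder ρ : ℂ) * ((1 : ℝ) : ℂ) ^ ρ =
      ∑ ρ ∈ (weilZeroIndex_finite T).toFinset, (riemannZetaZeroOrder ρ : ℂ) := by
  simp

/-! ### The Landau pairing of a Dirichlet polynomial -/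

/-- The characters: for `m, m' ≥ 1`,
`m^{ρ−½} · m'^{−(ρ−½)} = (√m'/√m) · (m/m')^ρ`. [folklore] -/
theorem cpow_mul_cpow_neg_eq {m m' : ℕ} (hm : 1 ≤ m) (hm' : 1 ≤ m') (ρ : ℂ) :
    (m : ℂ) ^ (ρ - 1 / 2) * (m' : ℂ) ^ (-(ρ - 1 / 2)) =
      ((Real.sqrt m' / Real.sqrt m : ℝ) : ℂ) * (((m : ℝ) / m' : ℝ) : ℂ) ^ ρ := by
  have hm0 : (0 : ℝ) < m := by exact_mod_cast hm
  have hm0' : (0 : ℝ) < m' := by exact_mod_cast hm'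
  have hmC : (m : ℂ) ≠ 0 := by exact_mod_cast hm0.ne'
  have hmC' : (m' : ℂ) ≠ 0 := by exact_mod_cast hm0'.ne'
  -- real square roots as complex powers
  have hsq : ∀ {k : ℕ}, (0 : ℝ) < k → (k : ℂ) ^ (1 / 2 : ℂ) = ((Real.sqrt k : ℝ) : ℂ) := by
    intro k hk
    rw [Real.sqrt_eq_rpow, ofReal_cpow hk.le]
    push_cast
    rfl
  have hsqm := hsq hm0
  have hsqm' := hsq hm0'
  have hdiv : (((m : ℝ) / m' : ℝ) : ℂ) ^ ρ = (m : ℂ) ^ ρ / (m' : ℂ) ^ ρ := by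
    rw [ofReal_div_cpow hm0.le hm0' ρ]
    push_cast
    rfl
  have hsqm0 : ((Real.sqrt m : ℝ) : ℂ) ≠ 0 := by
    exact_mod_cast (Real.sqrt_pos.2 hm0).ne'
  have hpow : (m' : ℂ) ^ ρ ≠ 0 := by
    rw [Ne, cpow_eq_zero_iff, not_and_or]; exact Or.inl hmC'
  rw [show ρ - 1 / 2 = ρ + (-(1 / 2 : ℂ)) by ring, cpow_add _ _ hmC, neg_add, neg_neg,
    cpow_add _ _ hmC', cpow_neg, cpow_neg, hsqm, hsqm', hdiv]
  push_cast
  field_simp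

/-- **The Landau pairing, termwise.** For a real vector `y` on `[1, M]` and any `ρ`,
`P_y(ρ−½) P_y(−(ρ−½)) = ∑_{m,m' ≤ M} y_m y_m' (√m'/√m) (m/m')^ρ`,
`P_y(s) = ∑_{m ≤ M} y_m m^s`. [folklore] -/
theorem pairing_eq (M : ℕ) (y : ℕ → ℝ) (ρ : ℂ) :
    (∑ m ∈ Icc 1 M, (y m : ℂ) * (m : ℂ) ^ (ρ - 1 / 2)) *
        (∑ m ∈ Icc 1 M, (y m : ℂ) * (m : ℂ) ^ (-(ρ - 1 / 2))) =
      ∑ m ∈ Icc 1 M, ∑ m' ∈ Icc 1 M,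
        (y m : ℂ) * (y m' : ℂ) * ((Real.sqrt m' / Real.sqrt m : ℝ) : ℂ) *
          (((m : ℝ) / m' : ℝ) : ℂ) ^ ρ := by
  rw [Finset.sum_mul_sum]
  refine Finset.sum_congr rfl fun m hm ↦ Finset.sum_congr rfl fun m' hm' ↦ ?_
  rw [Finset.mem_Icc] at hm hm'
  rw [mul_mul_mul_comm, cpow_mul_cpow_neg_eq hm.1 hm'.1 ρ]
  ring

/-- **The truncated pairing as a combination of Landau sums.** For a real vector `y` on `[1, M]`
and `T`,
`∑_{|Im ρ| ≤ T} m(ρ) P_y(ρ−½)P_y(−(ρ−½)) = ∑_{m,m' ≤ M} y_m y_m' (√m'/√m) ∑_{|Im ρ| ≤ T} m(ρ)(m/m')^ρ`.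
[folklore] -/
theorem pairingSum_eq (M : ℕ) (y : ℕ → ℝ) (T : ℝ) :
    ∑ ρ ∈ (weilZeroIndex_finite T).toFinset, (riemannZetaZeroOrder ρ : ℂ) *
        ((∑ m ∈ Icc 1 M, (y m : ℂ) * (m : ℂ) ^ (ρ - 1 / 2)) *
          (∑ m ∈ Icc 1 M, (y m : ℂ) * (m : ℂ) ^ (-(ρ - 1 / 2)))) =
      ∑ m ∈ Icc 1 M, ∑ m' ∈ Icc 1 M,
        (y m : ℂ) * (y m' : ℂ) * ((Real.sqrt m' / Real.sqrt m : ℝ) : ℂ) *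
          ∑ ρ ∈ (weilZeroIndex_finite T).toFinset,
            (riemannZetaZeroOrder ρ : ℂ) * (((m : ℝ) / m' : ℝ) : ℂ) ^ ρ := by
  simp_rw [pairing_eq, Finset.mul_sum]
  rw [Finset.sum_comm]
  refine Finset.sum_congr rfl fun m _ ↦ ?_
  rw [Finset.sum_comm]
  refine Finset.sum_congr rfl fun m' _ ↦ ?_
  refine Finset.sum_congr rfl fun ρ _ ↦ ?_
  ring

end Summit.RiemannHypothesis.RiemannHypothesis.Theorems.IntegerScrewLandau

end
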